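import Summits.BirchSwinnertonDyer.BirchSwinnertonDyer.Theorems.ErratumRoadFiveEulerHalfPOnlyMultOfHGZ
import Summits.BirchSwinnertonDyer.BirchSwinnertonDyer.Theorems.ErratumRoadFiveEulerHalfNotRamNoInertSetAtFiveOfSevenItems
import Summits.BirchSwinnertonDyer.BirchSwinnertonDyer.Theorems.ErratumRoadFiveEulerHalfJetchevMaxHLAtPSwapStub
import Summits.BirchSwinnertonDyer.BirchSwinnertonDyer.Theorems.ErratumRoadFiveEulerHalfNotRamNoInertSetOfBirth
import HarnessLib

/-!
# Route `ErratumRoadFive` (K2, `p ≥ 5`), crux `EulerHalfNotRamNoInertSetAtFive` (item stmt-BirchSwinnertonDyer-19715):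
# THE CRUX BY NAME FROM SIX ROUTE ITEMS + Gross 1991 Prop. 3.7 (2) (item 23091) + THE hGZ RECEPTACLE ON S1b ROWS — [GZ86 III (3.1)] NOT AN INPUT
# (cell `bsd-stepL`, width seat `bsd-line-er5-p1-w2` g6; `--supports stmt-BirchSwinnertonDyer-19715 --as helper`)

WHY. The v16 closers (`Theorems.eulerHalfNotRamNoInertSetAtFive_of_sevenItems` p651418 ∕ `EulerHalfGalTrivialRoad.…_of_items7` p650861) derive the crux from
SEVEN route items; the seventh, `EulerHalfGrossPrintFacts` (27981) = Gross 1991 Prop. 3.7 (2) ∧ [GZ86 III (3.1)] `Gross1991_heegnerPoint_sub_ratTorsion_mem_E0_imageFree`,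
is used only on the S1b branch («`p` the only multiplicative prime»), and its second conjunct only through four hGZ-keyed sites, re-threaded over a
per-curve RECEPTACLE by this seat's `…JetchevAtPSupplyOfHGZ` ∕ `…JetchevAtPSwapEndOfHGZ` ∕ `…McCallumUpperOfHGZ` ∕ `…EulerHalfPOnlyMultOfHGZ`. This file
re-assembles the crux over that chain: **the crux BY NAME from the SIX route items {`PublishedInputsFive` 19066, `X11aLowerHalf` 19064,
`ShimuraParametrizationDataNonempty` 19524, `PastenComponentOrdersInput` 19716, `ShimuraCasselsTateLevelInputs` 20191, `ShimuraHeegnerEulerSystemInertPrintedR`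
20442}, the route item `GrossFrobeniusCongruenceImageFreeFact` (23091 = conjunct 1 of 27981, BY NAME) and ONE displayed hypothesis `hRcp` — the hGZ
receptacle on S1b rows** (for every globally minimal `W`, `p ≥ 5` with `(W,p) ∈ X11b`, `ρ̄` onto, `p` the only multiplicative prime, split at `p`,
`p ∣ ord_p Δ_min`, every Heegner field `K` with `d_K < −4` and every conductor frame: the conclusion of `JET.hGZ_of_Gross1991`). Width seat -w5 g0's
«modular aux-norm» (`…ModularHGZOfAuxNorm` F-E over p651087–p651089 ∕ p651502, with -w6 g0's p648969 for its (T)/(C) hypotheses) is the intended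
SUPPLIER of `hRcp`; composing the two is the sequel (then 27981's second conjunct leaves 19715's cone and the closer reads «six items + 23091»).

* `res_pOnlyMultCarrierAtFive_of_items_of_frobeniusCongruence_of_hGZ` — S1b (registered text of `stub_res_pOnlyMultCarrierAtFive` + the receptacle
  hypothesis) from `PublishedInputsFive`, `X11aLowerHalf`, `ShimuraCasselsTateLevelInputs`, Gross Prop. 3.7 (2) — the `…_of_items_of_twoPrintFacts` of
  p632931 with ONE print fact (Poitou–Tate for Selmer structures from the kernel theorem `selmerComplement_canonical_holds`, as there).
* `eulerHalfNotRamNoInertSetAtFive_of_items_of_frobeniusCongruence_of_SAV_of_hGZ` — the crux from the six items + Prop. 3.7 (2) + SAV + the receptacle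
  (-w3 g5's `…_of_items_of_twoPrintFacts_of_SAV` p640637 with the S1b branch re-keyed; the `p`-anchor branch VERBATIM).
* **`eulerHalfNotRamNoInertSetAtFive_of_sixItems_of_frobeniusCongruence_of_hGZOnlyMult (h₅ h₃ hJL hCO hCTi hESi) (hF₁ : GrossFrobeniusCongruenceImageFreeFact) (hRcp)`**
  — the crux BY NAME; SAV := the LEAD's `EulerHalfAuxNorm.shimuraInertSavedDisplayAtFive_of_items_of_threeLeaves` over the three landed leaves S1-lin
  (p647332) ∕ (C) (p646145) ∕ (O) (p646799), exactly as in p651418.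

HONEST FRAMING: THEOREMS ONLY (no definition, no named fact, no `sorry`); CONDITIONAL on the displayed inputs (19064 is an open crux; five published-input
items; 23091 cite-only; the receptacle `hRcp` is a displayed HYPOTHESIS, not yet supplied in this file); item 19715 is NOT closed by this helper and no
stub credit is claimed; no census number moves (404 = 69 + 334 + 1 + 0); BSD is proved for no curve; no summit statement is touched (T7).
[cite: GrossLMS1991, Prop. 3.7 (2) (p. 240)] [cite: Jetchev2008, Thm. 1.1, Thm. 1.4, Cor. 1.5] [cite: PastenShimura2024, Prop. 6.13, Lemma 6.18, §6.6]
[cite: McCallumLMS1991, Cor. 5.6] [cite: MilneADT2006, Ch. I Thm. 4.10(b)] [cite: SilvermanATAEC1994, Cor. IV.9.2 (d)] [cite: CaiShuTian2014, Thm. 1.5]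
-/

set_option autoImplicit false
set_option linter.dupNamespace false -- `Summit.BirchSwinnertonDyer.BirchSwinnertonDyer` (summit = problem), tree-wide

noncomputable section

open scoped Classical NumberField

namespace Summit.BirchSwinnertonDyer.BirchSwinnertonDyer.Theorems.EulerHalfHGZ

open Summit.BirchSwinnertonDyer.BirchSwinnertonDyer.Theses.ErratumRoadFive
open WeierstrassCurve NumberField IsDedekindDomain
open Literature.NumberTheory.EllipticCurves Literature.NumberTheory.EllipticCurves.ModularForms
  Literature.NumberTheory.EllipticCurves.Rank1Residual Literature.NumberTheory.EllipticCurves.Rank1Residual.Typed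
open Summit.BirchSwinnertonDyer.Rank1Residual Summit.BirchSwinnertonDyer.Rank1Residual.X11b
  Summit.BirchSwinnertonDyer.Rank1Residual.X11b.Three.Koly Summit.BirchSwinnertonDyer.BirchSwinnertonDyer

/-! ### §1 S1b from three route items + Gross Prop. 3.7 (2) + the receptacle -/

/-- **S1b — the exceptional-zero core of crux 19715 (registered text of `stub_res_pOnlyMultCarrierAtFive` + ONE extra hypothesis, the hGZ receptacle
for the curve, placed last) from `PublishedInputsFive`, `X11aLowerHalf`, `ShimuraCasselsTateLevelInputs` and Gross 1991 Prop. 3.7 (2) image-free —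
[GZ86 III (3.1)] is NOT an input.** p632931's `res_pOnlyMultCarrierAtFive_of_items_of_twoPrintFacts` with the consumer re-keyed
(`JetchevMaxHLAtP.res_pOnlyMultCarrierAtFive_of_lowerX11aAt_of_hGZ`, the X11a lower half fed AT `p`); Poitou–Tate for Selmer structures from the kernel theorem
`selmerComplement_canonical_holds` through `Koly.poitouTate_conj_forall_of_selmerComplement_canonical`, Shimura reciprocity at conductor 1 and
`φ(τ) ∈ K[1]` by the Literature THEOREMS, as there. CONDITIONAL (open 19064, typed inputs, the receptacle); no pair booked.
[cite: Jetchev2008, Thm. 1.4, Cor. 1.5] [cite: McCallumLMS1991, Cor. 5.6] [cite: GrossLMS1991, Prop. 3.7 (2), §4 (4.1)] [cite: MilneADT2006, Ch. I Thm. 4.10(b)] -/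
theorem res_pOnlyMultCarrierAtFive_of_items_of_frobeniusCongruence_of_hGZ
    (h₅ : PublishedInputsFive) (h₃ : X11aLowerHalf) (hCTi : ShimuraCasselsTateLevelInputs)
    (hF₁ : GrossLMS1991.prop37_2_frobeniusCongruence) :
    ∀ (W : WeierstrassCurve ℚ) [W.IsElliptic] [W.IsGloballyMinimal] (p : ℕ) [Fact p.Prime],
      ClassX11b W p → 5 ≤ p → Surj W p → ¬ Ram W p → p ∣ W.tamagawaProduct →
      (∀ (ℓ : ℕ) [Fact ℓ.Prime], W.HasMultiplicativeReductionAtPrime ℓ → ℓ = p) →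
      W.HasSplitMultiplicativeReductionAtPrime p → p ∣ padicValInt p W.minimalDiscriminantInt →
      (∀ [NeZero (W.conductorNorm ℤ)] (K : Type) [Field K] [NumberField K], IsImaginaryQuadratic K →
        NumberField.discr K < -4 → SatisfiesHeegnerHypothesis (W.conductorNorm ℤ) K →
        ∀ (Dt : ModularParametrizationData W (W.conductorNorm ℤ)) (β : ℤ) (ι : K →+* ℂ),
        ∃ n' : ℤ, IsCoprime (p : ℤ) n' ∧ ∀ (m : ℕ), Squarefree m →
        (∀ q ∈ m.primeFactors, Zhang2014.IsKolyvaginPrime (W.conductorNorm ℤ) W K p q) →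
        ∀ (dm : KolyvaginHeegnerData Dt β ι m)
          (γ : ringClassField K ι m ≃ₐ[ℚ] ringClassField K ι m), γ ∈ ringClassGal ι m →
          ∀ v : HeightOneSpectrum (𝓞 K), ¬ (W.baseChange K).HasGoodReductionAt v →
            n' • pointsMap (W.baseChange K) (v.adicCompletion K)
                (dm.toGeomPoints (pointGalHom W (ringClassField K ι m) γ dm.y)) ∈
              E0Receptacle (W.baseChange K) v ∧
            ∀ (ℓ : ℕ), ℓ ∈ m.primeFactors → ∀ (dm' : KolyvaginHeegnerData Dt β ι (m / ℓ))
              (hle : ringClassField K ι (m / ℓ) ≤ ringClassField K ι m),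
              n' • pointsMap (W.baseChange K) (v.adicCompletion K)
                  (dm.toGeomPoints (pointGalHom W (ringClassField K ι m) γ
                    (WeierstrassCurve.Affine.Point.map (W' := W)
                      ((RingClassField.inclusion ι hle).restrictScalars ℚ) dm'.y))) ∈
                E0Receptacle (W.baseChange K) v) →
      Typed.MissingUpperBoundAt W p := by
  obtain ⟨hGZ, hKo, -, -, -, hGZK, hmod, hnf, hHL, -, hMaz, -, -, -, -⟩ := h₅
  intro W _ _ p _ hX hp5 hρ hnram htam honly hsplit hdvd hRcpW
  exact JetchevMaxHLAtP.res_pOnlyMultCarrierAtFive_of_lowerX11aAt_of_hGZ hGZ hKo hGZK hmod hnf hHL hMaz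
    (fun N _ W K _ _ ↦ heegnerPointOfConductor_one_galoisConj_holds N W K)
    (fun N _ W K _ _ ↦ phi_heegnerTau_mem_singularModuliField_holds N W K) hCTi hF₁
    (poitouTate_conj_forall_of_selmerComplement_canonical
      fun K _ _ n _ ↦ SchneiderFreeAdditiveX3.PoitouTateReduction.selmerComplement_canonical_holds K n)
    W p hX hp5 hρ hnram htam honly hsplit hdvd (fun Wd _ _ hXa ↦ h₃ Wd p hXa) hRcpW

/-! ### §2 The crux from the six items + Gross Prop. 3.7 (2) + SAV + the receptacle -/

/-- **CRUX 19715 BY NAME FROM THE SIX ROUTE ITEMS + Gross Prop. 3.7 (2) + SAV + THE hGZ RECEPTACLE ON S1b ROWS** — -w3 g5's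
`EulerHalfBirthAssembly.eulerHalfNotRamNoInertSetAtFive_of_items_of_twoPrintFacts_of_SAV` (p640637) with its binder `hF₃` ([GZ86 III (3.1)]) REPLACED by
the receptacle `hRcp` (used on the S1b branch only, via §1); the `p`-anchor branch (`EulerHalfPAnchor.eulerHalfNotRam_otherMult_of_pAnchor` on `hSav` with
the inert display from the items) VERBATIM. CONDITIONAL; 19715 NOT closed by this helper.
[cite: Jetchev2008, Thm. 1.4, Cor. 1.5] [cite: PastenShimura2024, Prop. 6.13, Lemma 6.18, §6.6] [cite: SilvermanATAEC1994, Cor. IV.9.2 (d)] -/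
theorem eulerHalfNotRamNoInertSetAtFive_of_items_of_frobeniusCongruence_of_SAV_of_hGZ
    (h₅ : PublishedInputsFive) (h₃ : X11aLowerHalf) (hJL : ShimuraParametrizationDataNonempty)
    (hCO : PastenComponentOrdersInput) (hCTi : ShimuraCasselsTateLevelInputs)
    (hESi : ShimuraHeegnerEulerSystemInertPrintedR)
    (hF₁ : GrossLMS1991.prop37_2_frobeniusCongruence)
    (hSav : ∀ (W : WeierstrassCurve ℚ) [W.IsElliptic] [W.IsGloballyMinimal] (p : ℕ) [Fact p.Prime]
      (q₁ : ℕ) [Fact q₁.Prime], ClassX11b W p → 5 ≤ p → Surj W p → ¬ Ram W p →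
      W.HasSplitMultiplicativeReductionAtPrime q₁ → p ∣ padicValInt q₁ W.minimalDiscriminantInt →
      Theorems.ShimuraInertSavedDisplayAtD W p q₁)
    (hRcp : ∀ (W : WeierstrassCurve ℚ) [W.IsElliptic] [W.IsGloballyMinimal] (p : ℕ) [Fact p.Prime],
      ClassX11b W p → 5 ≤ p → Surj W p →
      (∀ (ℓ : ℕ) [Fact ℓ.Prime], W.HasMultiplicativeReductionAtPrime ℓ → ℓ = p) →
      W.HasSplitMultiplicativeReductionAtPrime p → p ∣ padicValInt p W.minimalDiscriminantInt →
      (∀ [NeZero (W.conductorNorm ℤ)] (K : Type) [Field K] [NumberField K], IsImaginaryQuadratic K →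
        NumberField.discr K < -4 → SatisfiesHeegnerHypothesis (W.conductorNorm ℤ) K →
        ∀ (Dt : ModularParametrizationData W (W.conductorNorm ℤ)) (β : ℤ) (ι : K →+* ℂ),
        ∃ n' : ℤ, IsCoprime (p : ℤ) n' ∧ ∀ (m : ℕ), Squarefree m →
        (∀ q ∈ m.primeFactors, Zhang2014.IsKolyvaginPrime (W.conductorNorm ℤ) W K p q) →
        ∀ (dm : KolyvaginHeegnerData Dt β ι m)
          (γ : ringClassField K ι m ≃ₐ[ℚ] ringClassField K ι m), γ ∈ ringClassGal ι m →
          ∀ v : HeightOneSpectrum (𝓞 K), ¬ (W.baseChange K).HasGoodReductionAt v →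
            n' • pointsMap (W.baseChange K) (v.adicCompletion K)
                (dm.toGeomPoints (pointGalHom W (ringClassField K ι m) γ dm.y)) ∈
              E0Receptacle (W.baseChange K) v ∧
            ∀ (ℓ : ℕ), ℓ ∈ m.primeFactors → ∀ (dm' : KolyvaginHeegnerData Dt β ι (m / ℓ))
              (hle : ringClassField K ι (m / ℓ) ≤ ringClassField K ι m),
              n' • pointsMap (W.baseChange K) (v.adicCompletion K)
                  (dm.toGeomPoints (pointGalHom W (ringClassField K ι m) γ
                    (WeierstrassCurve.Affine.Point.map (W' := W)
                      ((RingClassField.inclusion ι hle).restrictScalars ℚ) dm'.y))) ∈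
                E0Receptacle (W.baseChange K) v)) :
    EulerHalfNotRamNoInertSetAtFive := by
  -- adapted from Summits/BirchSwinnertonDyer/BirchSwinnertonDyer/Theorems/ErratumRoadFiveEulerHalfNotRamNoInertSetOfSAV.lean (§1)
  intro W _ _ p _ hX hp5 hsurj hram htam _hno
  by_cases h : ∀ (ℓ : ℕ) [Fact ℓ.Prime], W.HasMultiplicativeReductionAtPrime ℓ → ℓ = p
  · -- `p` is the only multiplicative prime: the split carrier that `p ∣ ∏c` provides is multiplicative, hence it is `p`
    obtain ⟨ℓ, hℓ, hsplit, hdvd⟩ := (X11b.dvd_tamagawaProduct_iff_exists_split (W := W) (Fact.out : p.Prime) hp5).mp htam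
    have hℓp : ℓ = p := h ℓ hsplit.hasMultiplicativeReductionAtPrime
    subst hℓp
    exact res_pOnlyMultCarrierAtFive_of_items_of_frobeniusCongruence_of_hGZ h₅ h₃ hCTi hF₁ W _ hX hp5 hsurj hram htam h
      hsplit hdvd (hRcp W _ hX hp5 hsurj h hsplit hdvd)
  · have hother : ∃ (ℓ : ℕ) (_ : Fact ℓ.Prime), ℓ ≠ p ∧ W.HasMultiplicativeReductionAtPrime ℓ := by
      by_contra hc
      exact h fun ℓ _ hm ↦ by_contra fun hne ↦ hc ⟨ℓ, ‹_›, hne, hm⟩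
    exact Theorems.EulerHalfPAnchor.eulerHalfNotRam_otherMult_of_pAnchor h₅ h₃ hJL hCO
      (Theorems.EulerHalfPAnchor.shimuraInertDisplayKolyvagin_of_items h₅ hCTi hESi) hSav W p hX hp5 hsurj hram hother

/-! ### §3 The crux from the six items + item 23091 + the receptacle (SAV from the three landed leaves of the auxiliary-norm lever) -/

/-- **CRUX 19715 `EulerHalfNotRamNoInertSetAtFive` BY NAME FROM SIX ROUTE ITEMS + `GrossFrobeniusCongruenceImageFreeFact` (item 23091) + THE hGZ RECEPTACLE
ON S1b ROWS — [GZ86 III (3.1)] (conjunct 2 of item 27981) is NOT an input.** For every X11b pair `(E, p)` with `p ≥ 5`, `ρ̄_{E,p}` onto, no (ram) prime,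
`p ∣ ∏ c_ℓ` and no inert-set datum: `Typed.MissingUpperBoundAt E p` — GIVEN the route items `PublishedInputsFive`, `X11aLowerHalf`,
`ShimuraParametrizationDataNonempty`, `PastenComponentOrdersInput`, `ShimuraCasselsTateLevelInputs`, `ShimuraHeegnerEulerSystemInertPrintedR`,
`GrossFrobeniusCongruenceImageFreeFact`, and the receptacle `hRcp`. := §2 with SAV := the LEAD's `EulerHalfAuxNorm.shimuraInertSavedDisplayAtFive_of_items_of_threeLeaves`
over the three landed leaves (S1-lin `TateComponent.stub_tateComponentFamilyLinear`, (C) `Theorems.stub_chebotarevKummerSupply`, (O)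
`Theorems.stub_splitPrimeKummerWitness`), as in p651418. CONDITIONAL on the displayed inputs; the intended supplier of `hRcp` is -w5 g0's modular aux-norm
(`…ModularHGZOfAuxNorm`); 19715 stays ledger-`open`; BSD is proved for no curve.
[cite: GrossLMS1991, Prop. 3.7 (2) (p. 240)] [cite: Jetchev2008, Thm. 1.4, Cor. 1.5] [cite: PastenShimura2024, Lemma 6.18, Prop. 6.13] [cite: Cox2013, Thm. 8.12, §9.A] -/
theorem eulerHalfNotRamNoInertSetAtFive_of_sixItems_of_frobeniusCongruence_of_hGZOnlyMult
    (h₅ : PublishedInputsFive) (h₃ : X11aLowerHalf) (hJL : ShimuraParametrizationDataNonempty)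
    (hCO : PastenComponentOrdersInput) (hCTi : ShimuraCasselsTateLevelInputs)
    (hESi : ShimuraHeegnerEulerSystemInertPrintedR) (hF₁ : GrossFrobeniusCongruenceImageFreeFact)
    (hRcp : ∀ (W : WeierstrassCurve ℚ) [W.IsElliptic] [W.IsGloballyMinimal] (p : ℕ) [Fact p.Prime],
      ClassX11b W p → 5 ≤ p → Surj W p →
      (∀ (ℓ : ℕ) [Fact ℓ.Prime], W.HasMultiplicativeReductionAtPrime ℓ → ℓ = p) →
      W.HasSplitMultiplicativeReductionAtPrime p → p ∣ padicValInt p W.minimalDiscriminantInt →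
      (∀ [NeZero (W.conductorNorm ℤ)] (K : Type) [Field K] [NumberField K], IsImaginaryQuadratic K →
        NumberField.discr K < -4 → SatisfiesHeegnerHypothesis (W.conductorNorm ℤ) K →
        ∀ (Dt : ModularParametrizationData W (W.conductorNorm ℤ)) (β : ℤ) (ι : K →+* ℂ),
        ∃ n' : ℤ, IsCoprime (p : ℤ) n' ∧ ∀ (m : ℕ), Squarefree m →
        (∀ q ∈ m.primeFactors, Zhang2014.IsKolyvaginPrime (W.conductorNorm ℤ) W K p q) →
        ∀ (dm : KolyvaginHeegnerData Dt β ι m)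
          (γ : ringClassField K ι m ≃ₐ[ℚ] ringClassField K ι m), γ ∈ ringClassGal ι m →
          ∀ v : HeightOneSpectrum (𝓞 K), ¬ (W.baseChange K).HasGoodReductionAt v →
            n' • pointsMap (W.baseChange K) (v.adicCompletion K)
                (dm.toGeomPoints (pointGalHom W (ringClassField K ι m) γ dm.y)) ∈
              E0Receptacle (W.baseChange K) v ∧
            ∀ (ℓ : ℕ), ℓ ∈ m.primeFactors → ∀ (dm' : KolyvaginHeegnerData Dt β ι (m / ℓ))
              (hle : ringClassField K ι (m / ℓ) ≤ ringClassField K ι m),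
              n' • pointsMap (W.baseChange K) (v.adicCompletion K)
                  (dm.toGeomPoints (pointGalHom W (ringClassField K ι m) γ
                    (WeierstrassCurve.Affine.Point.map (W' := W)
                      ((RingClassField.inclusion ι hle).restrictScalars ℚ) dm'.y))) ∈
                E0Receptacle (W.baseChange K) v)) :
    EulerHalfNotRamNoInertSetAtFive :=
  eulerHalfNotRamNoInertSetAtFive_of_items_of_frobeniusCongruence_of_SAV_of_hGZ h₅ h₃ hJL hCO hCTi hESi hF₁
    (EulerHalfAuxNorm.shimuraInertSavedDisplayAtFive_of_items_of_threeLeaves h₅ hCTi hESi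
      (fun W _ _ K _ _ ι _ hK q _ hs hq2 ↦ TateComponent.stub_tateComponentFamilyLinear W K ι hK q hs hq2)
      (fun W _ _ K _ _ hK hdK p _ hp5 hsurj ↦ stub_chebotarevKummerSupply W K hK hdK p hp5 hsurj)
      (fun K _ _ hK hdK p _ hp3 q _ hq2 ↦ stub_splitPrimeKummerWitness K hK hdK p hp3 q hq2))
    hRcp

end Summit.BirchSwinnertonDyer.BirchSwinnertonDyer.Theorems.EulerHalfHGZ

end
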